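import Summits.AtomisticToContinuum.HydrodynamicLimit.Theses.AntiMazurCoboundaries
import Literature.MathematicalPhysics.KineticTheory.HardSphereEulerProofs
import Literature.MathematicalPhysics.KineticTheory.HardBallErgodicity
import Literature.Probability.Divergences.FDivVariational

/-!
# Stub `stub_sliceGlue` of line `almost-invariant-duality` — crux `AntiMazurCoboundaries.CorrectorPressureDecay`
(stmt-AtomisticToContinuum-14135)

Helper file (`--supports stmt-AtomisticToContinuum-14135`) proving the registered stub `stub_sliceGlue` of the lead's skeleton
`Cruxes/CorrectorPressureDecay/Lines/almost-invariant-duality.lean`. The statement is spelled over tree primitives exactly as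
registered: it glues the three true stubs `ThermodynamicProfile` (Doob profile `f(P,E)` of a bounded density),
`ShellMeanBound` (`|∫ F·B(P,E) dG_N| ≤ κC₀ ∫((N+1)ω + 1)B(P,E) dG_N`) and `ShellChernoff`
(`∫ exp(A(N+1)ω(P,E)) dG_N ≤ e^{δ(N+1)}` for `A ≤ A₀`, `N ≥ N₀`) into the anchor `ThermodynamicSliceFloor`.

Proof. Two generic lemmas and bookkeeping:
* `integral_mul_sub_entropy_le_log_integral_exp` — the ENTROPY (Gibbs / Donsker–Varadhan) INEQUALITY for a bounded
  density on a probability space: `∫ Y q − ∫ q log q ≤ log ∫ e^Y` for a bounded measurable `Y` and a bounded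
  measurable `q ≥ 0` with `∫ q = 1`. It is the pointwise Fenchel–Young inequality
  `x·y ≤ (x log x + 1 − x) + (e^y − 1)` (tree lemma `Literature.Probability.Divergences.klFun_fenchelYoung`) at
  `x = q`, `y = Y − log ∫e^Y`, integrated.
* `two_mul_integral_sub_entropy_le` — the abstract glue: from `|∫ F q| ≤ κC₀ ∫ (nω + 1) q`, `κC₀ = A₀/2`,
  `∫ q = 1`, `∫ e^{A₀ n ω} ≤ e^{(δ/2) n}` and `A₀ ≤ (δ/2) n` one gets `2∫ F q − ∫ q log q ≤ δ n`
  (`2∫Fq ≤ A₀ n ∫ωq + A₀`, entropy inequality with `Y = A₀ n ω`).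
* the registered statement: `σ₀ := 1/2`; with `C₀` from the shell mean bound and `A₀` from the Chernoff layer put
  `κ := A₀/(2C₀)`; given `δ`, take `N₁` from the Chernoff layer at `A = A₀`, `δ/2`, and `N₀ := max N₁ ⌈2A₀/δ⌉₊`; for a
  bounded density `ρ` output its thermodynamic profile `f` and apply the abstract glue to `q = f(P,E)` (`∫ q = ∫ ρ = 1`
  by testing against `B ≡ 1`; `G_N` is a probability measure for `σ ≤ 1/2`, tree theorem
  `isProbabilityMeasure_localGibbsLaw`).
-/

noncomputable section

open MeasureTheory ProbabilityTheory Set Filter Topology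
open scoped ENNReal

namespace Summit.AtomisticToContinuum.HydrodynamicLimit.Theorems.AlmostInvariantDuality

open Literature.MathematicalPhysics.KineticTheory (T3 V3 hsDiameter localGibbsLaw)
open Literature.Analysis.FluidPDE (HardSphereFlow Config configMomentum configEnergy)

/-- A measurable real function with `|f| ≤ C` is integrable against a finite measure. -/
private theorem integrable_of_measurable_of_abs_le {α : Type*} [MeasurableSpace α] {μ : Measure α}
    [IsFiniteMeasure μ] {f : α → ℝ} (hfm : Measurable f) {C : ℝ} (hfC : ∀ x, |f x| ≤ C) :
    Integrable f μ :=
  Integrable.of_bound hfm.aestronglyMeasurable C (ae_of_all _ fun x => by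
    rw [Real.norm_eq_abs]; exact hfC x)

/-- `u ↦ u log u` is bounded on every interval `[0, C]` (it is continuous). -/
private theorem exists_abs_mul_log_le_of_le (C : ℝ) : ∃ K : ℝ, ∀ u, 0 ≤ u → u ≤ C → |u * Real.log u| ≤ K := by
  obtain ⟨K, hK⟩ := (isCompact_Icc (a := (0 : ℝ)) (b := C)).exists_bound_of_continuousOn
    Real.continuous_mul_log.continuousOn
  exact ⟨K, fun u hu0 huC => by simpa [Real.norm_eq_abs] using hK u ⟨hu0, huC⟩⟩

/-- **Entropy (Gibbs / Donsker–Varadhan) inequality for a bounded density.** On a probability space, for a bounded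
measurable `q ≥ 0` with `∫ q dμ = 1` and a bounded measurable `Y`:
`∫ Y q dμ − ∫ q log q dμ ≤ log ∫ e^Y dμ`. Proof: integrate the pointwise Fenchel–Young inequality
`q (Y − log Z) ≤ (q log q + 1 − q) + (e^{Y − log Z} − 1)`, `Z = ∫ e^Y dμ`. -/
theorem integral_mul_sub_entropy_le_log_integral_exp {α : Type*} [MeasurableSpace α] {μ : Measure α}
    [IsProbabilityMeasure μ] {q Y : α → ℝ} (hqm : Measurable q) (hYm : Measurable Y)
    (hq0 : ∀ x, 0 ≤ q x) {C : ℝ} (hqC : ∀ x, q x ≤ C) {K : ℝ} (hYK : ∀ x, |Y x| ≤ K)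
    (hq1 : ∫ x, q x ∂μ = 1) :
    ∫ x, Y x * q x ∂μ - ∫ x, q x * Real.log (q x) ∂μ ≤ Real.log (∫ x, Real.exp (Y x) ∂μ) := by
  have hqabs : ∀ x, |q x| ≤ C := fun x => by rw [abs_of_nonneg (hq0 x)]; exact hqC x
  have hqi : Integrable q μ := integrable_of_measurable_of_abs_le hqm hqabs
  have hexpi : Integrable (fun x => Real.exp (Y x)) μ := by
    refine integrable_of_measurable_of_abs_le hYm.exp (C := Real.exp K) fun x => ?_
    rw [abs_of_pos (Real.exp_pos _)]
    exact Real.exp_le_exp.2 ((le_abs_self _).trans (hYK x))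
  have hYqi : Integrable (fun x => Y x * q x) μ :=
    hqi.bdd_mul hYm.aestronglyMeasurable (ae_of_all _ fun x => by
      rw [Real.norm_eq_abs]; exact hYK x)
  obtain ⟨L, hL⟩ := exists_abs_mul_log_le_of_le C
  have hqlogi : Integrable (fun x => q x * Real.log (q x)) μ :=
    integrable_of_measurable_of_abs_le (hqm.mul (Real.measurable_log.comp hqm))
      fun x => hL _ (hq0 x) (hqC x)
  obtain ⟨Z, hZ⟩ : ∃ Z : ℝ, ∫ x, Real.exp (Y x) ∂μ = Z := ⟨_, rfl⟩
  have hZpos : 0 < Z := hZ ▸ integral_exp_pos hexpi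
  rw [hZ]
  -- pointwise Fenchel–Young
  have hpt : ∀ x, Y x * q x - q x * Real.log (q x) ≤
      Real.log Z * q x + (Z⁻¹ * Real.exp (Y x) - q x) := by
    intro x
    have h := Literature.Probability.Divergences.klFun_fenchelYoung (hq0 x) (Y x - Real.log Z)
    rw [InformationTheory.klFun_apply, Real.exp_sub, Real.exp_log hZpos, div_eq_inv_mul] at h
    nlinarith [h]
  have hrhs : Integrable (fun x => Real.log Z * q x + (Z⁻¹ * Real.exp (Y x) - q x)) μ :=
    (hqi.const_mul _).add ((hexpi.const_mul _).sub' hqi)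
  have hmono := integral_mono (hYqi.sub' hqlogi) hrhs hpt
  rw [integral_sub hYqi hqlogi, integral_add (hqi.const_mul _) ((hexpi.const_mul _).sub' hqi),
    integral_sub (hexpi.const_mul _) hqi, integral_const_mul, integral_const_mul, hq1, hZ,
    inv_mul_cancel₀ hZpos.ne'] at hmono
  linarith

/-- **Abstract glue.** On a probability space let `q ≥ 0` be a bounded measurable density (`∫ q = 1`), `ω` a
measurable function with `0 ≤ ω ≤ 1`, `n ≥ 0`, `A₀ ≥ 0`, `κ C₀ = A₀ / 2`. If `|∫ F q| ≤ κC₀ ∫ (nω + 1) q` (shell mean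
bound), `∫ e^{A₀ n ω} ≤ e^{(δ/2) n}` (Chernoff layer) and `A₀ ≤ (δ/2) n`, then `2∫ F q − ∫ q log q ≤ δ n`. -/
theorem two_mul_integral_sub_entropy_le {α : Type*} [MeasurableSpace α] {μ : Measure α}
    [IsProbabilityMeasure μ] {F q ω : α → ℝ} {A₀ C₀ κ δ n Cf : ℝ}
    (hqm : Measurable q) (hωm : Measurable ω) (hq0 : ∀ x, 0 ≤ q x) (hqC : ∀ x, q x ≤ Cf)
    (hω0 : ∀ x, 0 ≤ ω x) (hω1 : ∀ x, ω x ≤ 1) (hn : 0 ≤ n) (hA₀ : 0 ≤ A₀) (hκ : κ * C₀ = A₀ / 2)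
    (hq1 : ∫ x, q x ∂μ = 1)
    (hmean : |∫ x, F x * q x ∂μ| ≤ κ * C₀ * ∫ x, (n * ω x + 1) * q x ∂μ)
    (hcher : ∫ x, Real.exp (A₀ * (n * ω x)) ∂μ ≤ Real.exp (δ / 2 * n))
    (hAn : A₀ ≤ δ / 2 * n) :
    2 * ∫ x, F x * q x ∂μ - ∫ x, q x * Real.log (q x) ∂μ ≤ δ * n := by
  have hqabs : ∀ x, |q x| ≤ Cf := fun x => by rw [abs_of_nonneg (hq0 x)]; exact hqC x
  have hqi : Integrable q μ := integrable_of_measurable_of_abs_le hqm hqabs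
  -- the exponent `Y = A₀ n ω`, bounded by `A₀ n`
  have hYm : Measurable fun x => A₀ * (n * ω x) := measurable_const.mul (measurable_const.mul hωm)
  have hYK : ∀ x, |A₀ * (n * ω x)| ≤ A₀ * n := fun x => by
    rw [abs_of_nonneg (mul_nonneg hA₀ (mul_nonneg hn (hω0 x)))]
    exact mul_le_mul_of_nonneg_left (mul_le_of_le_one_right hn (hω1 x)) hA₀
  have hDV := integral_mul_sub_entropy_le_log_integral_exp hqm hYm hq0 hqC hYK hq1
  have hexpi : Integrable (fun x => Real.exp (A₀ * (n * ω x))) μ := by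
    refine integrable_of_measurable_of_abs_le hYm.exp (C := Real.exp (A₀ * n)) fun x => ?_
    rw [abs_of_pos (Real.exp_pos _)]
    exact Real.exp_le_exp.2 ((le_abs_self _).trans (hYK x))
  have hlog : Real.log (∫ x, Real.exp (A₀ * (n * ω x)) ∂μ) ≤ δ / 2 * n := by
    rw [Real.log_le_iff_le_exp (integral_exp_pos hexpi)]
    exact hcher
  -- the shell mean bound: `2 ∫ F q ≤ ∫ Y q + A₀`
  have hYqi : Integrable (fun x => A₀ * (n * ω x) * q x) μ :=
    hqi.bdd_mul hYm.aestronglyMeasurable (ae_of_all _ fun x => by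
      rw [Real.norm_eq_abs]; exact hYK x)
  have hsplit : A₀ * ∫ x, (n * ω x + 1) * q x ∂μ = ∫ x, A₀ * (n * ω x) * q x ∂μ + A₀ := by
    rw [← integral_const_mul]
    have h : ∀ x, A₀ * ((n * ω x + 1) * q x) = A₀ * (n * ω x) * q x + A₀ * q x := fun x => by ring
    simp_rw [h]
    rw [integral_add hYqi (hqi.const_mul _), integral_const_mul, hq1, mul_one]
  have h1 : ∫ x, F x * q x ∂μ ≤ κ * C₀ * ∫ x, (n * ω x + 1) * q x ∂μ := (le_abs_self _).trans hmean
  rw [hκ] at h1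
  have h2 : 2 * ∫ x, F x * q x ∂μ ≤ ∫ x, A₀ * (n * ω x) * q x ∂μ + A₀ := by linarith
  linarith

/-- The reduced shell deviation `ω(P(z), E(z))` is a continuous function on phase space. -/
private theorem continuous_shellDev_comp (θ : ℝ) (u₀ : V3) (N : ℕ) :
    Continuous fun z : Config (N + 1) (Fin 3) T3 =>
      min 1 (‖(Real.sqrt θ)⁻¹ • ((((N : ℝ) + 1))⁻¹ • (configMomentum z) - u₀)‖ ^ 2 +
        ((θ * ((N : ℝ) + 1))⁻¹ * (2 * (configEnergy z) - 2 * inner ℝ u₀ (configMomentum z) +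
          ((N : ℝ) + 1) * ‖u₀‖ ^ 2) / 3 - 1) ^ 2) := by
  have h1 := Literature.MathematicalPhysics.KineticTheory.continuous_configMomentum (N := N + 1) (d := Fin 3)
  have h2 := Literature.MathematicalPhysics.KineticTheory.continuous_configEnergy (N := N + 1) (d := Fin 3)
  fun_prop

/-- STUB 3d (size M; TRUE — GLUE `ThermodynamicProfile → ShellMeanBound → ShellChernoff → ThermodynamicSliceFloor` by the
entropy inequality). With `C₀` from 3b and `A₀` from 3c put `κ := A₀/(2C₀)`; for a bounded density `ρ` take its profile
`f` (3a); 3b tested with `B := f` gives `2∫F f(P,E) dG ≤ 2κC₀((N+1)∫ω f dG + 1)`, and Donsker–Varadhan for the probability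
law `f(P,E)·G_N` and the bounded function `Y = 2κC₀(N+1)ω(P,E)` gives `∫Y f − ∫f log f ≤ log∫e^Y dG ≤ (δ/2)(N+1)` (3c at
`A = A₀`, `δ/2`), so the dual value is `≤ (δ/2)(N+1) + A₀ ≤ δ(N+1)` for `N + 1 ≥ 2A₀/δ`. -/
theorem stub_sliceGlue :
    (∀ (σ a θ : ℝ) (u₀ : V3), 0 < σ → σ ≤ 1 / 2 → 0 < a → 0 < θ → ∀ (N : ℕ)
      (Φ : HardSphereFlow (Literature.Analysis.FluidPDE.Torus.geometry (Fin 3)) (hsDiameter σ N) (N + 1)),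
      ∀ ρ : Config (N + 1) (Fin 3) T3 → ℝ, Measurable ρ → (∀ z, 0 ≤ ρ z) → (∃ C : ℝ, ∀ z, ρ z ≤ C) →
        ∫ z, ρ z ∂(localGibbsLaw σ (fun _ => a) (fun _ => u₀) (fun _ => θ) N Φ) = 1 →
        ∃ f : V3 → ℝ → ℝ, Measurable (fun p : V3 × ℝ => f p.1 p.2) ∧ (∀ p e, 0 ≤ f p e) ∧
          (∃ C : ℝ, ∀ p e, f p e ≤ C) ∧
          ∀ B : V3 → ℝ → ℝ, Measurable (fun p : V3 × ℝ => B p.1 p.2) → (∃ C : ℝ, ∀ p e, |B p e| ≤ C) →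
            ∫ z, B (configMomentum z) (configEnergy z) * ρ z ∂(localGibbsLaw σ (fun _ => a) (fun _ => u₀) (fun _ => θ) N Φ) =
              ∫ z, B (configMomentum z) (configEnergy z) *
                f (configMomentum z) (configEnergy z) ∂(localGibbsLaw σ (fun _ => a) (fun _ => u₀) (fun _ => θ) N Φ)) →
    (∃ C₀ : ℝ, 1 ≤ C₀ ∧ ∀ (σ a θ : ℝ) (u₀ : V3), 0 < σ → σ ≤ 1 / 2 → 0 < a → 0 < θ →
      ∀ (κ : ℝ) (φ : T3 → ℝ) (g : V3 → ℝ), Continuous φ → Continuous g → (∀ x, |φ x| ≤ 1) →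
        (∀ v, |g v| ≤ κ) →
        (∀ (c₀ c₂ : ℝ) (b : V3),
          ∫ v, g v * (c₀ + inner ℝ b v + c₂ * ‖v‖ ^ 2) ∂(stdGaussian V3) = 0) →
        ∀ (N : ℕ) (Φ : HardSphereFlow (Literature.Analysis.FluidPDE.Torus.geometry (Fin 3)) (hsDiameter σ N) (N + 1)),
          ∀ B : V3 → ℝ → ℝ, Measurable (fun p : V3 × ℝ => B p.1 p.2) → (∀ p e, 0 ≤ B p e) →
            (∃ C : ℝ, ∀ p e, B p e ≤ C) →
            |∫ z, (∑ i, φ (z i).1 * g ((Real.sqrt θ)⁻¹ • ((z i).2 - u₀))) * B (configMomentum z) (configEnergy z)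
                ∂(localGibbsLaw σ (fun _ => a) (fun _ => u₀) (fun _ => θ) N Φ)| ≤
              κ * C₀ * ∫ z, (((N : ℝ) + 1) *
                min 1 (‖(Real.sqrt θ)⁻¹ • ((((N : ℝ) + 1))⁻¹ • (configMomentum z) - u₀)‖ ^ 2 +
              ((θ * ((N : ℝ) + 1))⁻¹ * (2 * (configEnergy z) - 2 * inner ℝ u₀ (configMomentum z) + ((N : ℝ) + 1) * ‖u₀‖ ^ 2) / 3 - 1) ^ 2) + 1) *
                B (configMomentum z) (configEnergy z) ∂(localGibbsLaw σ (fun _ => a) (fun _ => u₀) (fun _ => θ) N Φ)) →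
    (∃ A₀ : ℝ, 0 < A₀ ∧ ∀ (σ a θ : ℝ) (u₀ : V3), 0 < σ → σ ≤ 1 / 2 → 0 < a → 0 < θ →
      ∀ A : ℝ, 0 ≤ A → A ≤ A₀ → ∀ δ : ℝ, 0 < δ → ∃ N₀ : ℕ, ∀ N : ℕ, N₀ ≤ N →
        ∀ Φ : HardSphereFlow (Literature.Analysis.FluidPDE.Torus.geometry (Fin 3)) (hsDiameter σ N) (N + 1),
          ∫ z, Real.exp (A * (((N : ℝ) + 1) *
            min 1 (‖(Real.sqrt θ)⁻¹ • ((((N : ℝ) + 1))⁻¹ • (configMomentum z) - u₀)‖ ^ 2 +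
              ((θ * ((N : ℝ) + 1))⁻¹ * (2 * (configEnergy z) - 2 * inner ℝ u₀ (configMomentum z) + ((N : ℝ) + 1) * ‖u₀‖ ^ 2) / 3 - 1) ^ 2)))
            ∂(localGibbsLaw σ (fun _ => a) (fun _ => u₀) (fun _ => θ) N Φ) ≤ Real.exp (δ * ((N : ℝ) + 1))) →
    ∀ (a θ : ℝ) (u₀ : V3), 0 < a → 0 < θ → ∃ σ₀ : ℝ, 0 < σ₀ ∧ ∀ σ : ℝ, 0 < σ → σ < σ₀ →
      ∃ κ : ℝ, 0 < κ ∧ ∀ (φ : T3 → ℝ) (g : V3 → ℝ), Continuous φ → Continuous g →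
        (∀ x, |φ x| ≤ 1) → (∀ v, |g v| ≤ κ) →
        (∀ (c₀ c₂ : ℝ) (b : V3),
          ∫ v, g v * (c₀ + inner ℝ b v + c₂ * ‖v‖ ^ 2) ∂(stdGaussian V3) = 0) →
        ∀ δ : ℝ, 0 < δ → ∃ N₀ : ℕ, ∀ N : ℕ, N₀ ≤ N →
          ∀ Φ : HardSphereFlow (Literature.Analysis.FluidPDE.Torus.geometry (Fin 3)) (hsDiameter σ N) (N + 1),
          ∀ ρ : Config (N + 1) (Fin 3) T3 → ℝ, Measurable ρ → (∀ z, 0 ≤ ρ z) → (∃ C : ℝ, ∀ z, ρ z ≤ C) →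
            ∫ z, ρ z ∂(localGibbsLaw σ (fun _ => a) (fun _ => u₀) (fun _ => θ) N Φ) = 1 →
            ∃ f : V3 → ℝ → ℝ, Measurable (fun p : V3 × ℝ => f p.1 p.2) ∧ (∀ p e, 0 ≤ f p e) ∧
              (∃ C : ℝ, ∀ p e, f p e ≤ C) ∧
              (∀ B : V3 → ℝ → ℝ, Measurable (fun p : V3 × ℝ => B p.1 p.2) →
                (∃ C : ℝ, ∀ p e, |B p e| ≤ C) →
                ∫ z, B (configMomentum z) (configEnergy z) * ρ z ∂(localGibbsLaw σ (fun _ => a) (fun _ => u₀) (fun _ => θ) N Φ) =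
                  ∫ z, B (configMomentum z) (configEnergy z) *
                    f (configMomentum z) (configEnergy z) ∂(localGibbsLaw σ (fun _ => a) (fun _ => u₀) (fun _ => θ) N Φ)) ∧
              2 * ∫ z, (∑ i, φ (z i).1 * g ((Real.sqrt θ)⁻¹ • ((z i).2 - u₀))) *
                    f (configMomentum z) (configEnergy z) ∂(localGibbsLaw σ (fun _ => a) (fun _ => u₀) (fun _ => θ) N Φ) -
                  ∫ z, f (configMomentum z) (configEnergy z) *
                    Real.log (f (configMomentum z) (configEnergy z)) ∂(localGibbsLaw σ (fun _ => a) (fun _ => u₀) (fun _ => θ) N Φ)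
                ≤ δ * (N + 1) := by
  intro hProf hMean hCher a θ u₀ ha hθ
  obtain ⟨C₀, hC₀, hMean⟩ := hMean
  obtain ⟨A₀, hA₀, hCher⟩ := hCher
  refine ⟨1 / 2, one_half_pos, fun σ hσ hσh => ?_⟩
  have hσ2 : σ ≤ 1 / 2 := hσh.le
  have hC₀pos : 0 < C₀ := one_pos.trans_le hC₀
  refine ⟨A₀ / (2 * C₀), by positivity, fun φ g hφ hg hφ1 hgκ horth δ hδ => ?_⟩
  obtain ⟨N₁, hN₁⟩ := hCher σ a θ u₀ hσ hσ2 ha hθ A₀ hA₀.le le_rfl (δ / 2) (half_pos hδ)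
  refine ⟨max N₁ ⌈2 * A₀ / δ⌉₊, fun N hN Φ ρ hρm hρ0 hρC hρ1 => ?_⟩
  obtain ⟨f, hfm, hf0, ⟨Cf, hfC⟩, htest⟩ := hProf σ a θ u₀ hσ hσ2 ha hθ N Φ ρ hρm hρ0 hρC hρ1
  refine ⟨f, hfm, hf0, ⟨Cf, hfC⟩, htest, ?_⟩
  haveI : IsProbabilityMeasure (localGibbsLaw σ (fun _ => a) (fun _ => u₀) (fun _ => θ) N Φ) :=
    Literature.MathematicalPhysics.KineticTheory.isProbabilityMeasure_localGibbsLaw continuous_const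
      continuous_const continuous_const (fun _ => ha) (fun _ => hθ) hσ2 N Φ
  -- measurability of the profile and of the shell deviation along `(P, E)`
  have hS : Measurable fun z : Config (N + 1) (Fin 3) T3 => (configMomentum z, configEnergy z) :=
    (Literature.MathematicalPhysics.KineticTheory.continuous_configMomentum.prodMk
      Literature.MathematicalPhysics.KineticTheory.continuous_configEnergy).measurable
  have hqm : Measurable fun z : Config (N + 1) (Fin 3) T3 => f (configMomentum z) (configEnergy z) :=
    hfm.comp hS
  have hωm := (continuous_shellDev_comp θ u₀ N).measurable
  -- `∫ f(P,E) dG = ∫ ρ dG = 1` (test against `B ≡ 1`)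
  have hq1 : ∫ z, f (configMomentum z) (configEnergy z)
      ∂(localGibbsLaw σ (fun _ => a) (fun _ => u₀) (fun _ => θ) N Φ) = 1 := by
    have h := htest (fun _ _ => (1 : ℝ)) measurable_const ⟨1, fun _ _ => by simp⟩
    simp only [one_mul] at h
    rw [← h, hρ1]
  -- `A₀ ≤ (δ/2)(N+1)` from `N ≥ ⌈2A₀/δ⌉₊`
  have hAn : A₀ ≤ δ / 2 * ((N : ℝ) + 1) := by
    have h1 : (⌈2 * A₀ / δ⌉₊ : ℝ) ≤ N := by exact_mod_cast (le_max_right _ _).trans hN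
    have h2 : 2 * A₀ / δ ≤ N := (Nat.le_ceil _).trans h1
    rw [div_le_iff₀ hδ] at h2
    nlinarith [hA₀.le, hδ.le]
  have hκ : A₀ / (2 * C₀) * C₀ = A₀ / 2 := by
    field_simp
  have hmean := hMean σ a θ u₀ hσ hσ2 ha hθ (A₀ / (2 * C₀)) φ g hφ hg hφ1 hgκ horth N Φ f hfm hf0 ⟨Cf, hfC⟩
  have hcher := hN₁ N ((le_max_left _ _).trans hN) Φ
  exact two_mul_integral_sub_entropy_le
    (μ := localGibbsLaw σ (fun _ => a) (fun _ => u₀) (fun _ => θ) N Φ)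
    (F := fun z => ∑ i, φ (z i).1 * g ((Real.sqrt θ)⁻¹ • ((z i).2 - u₀)))
    (q := fun z => f (configMomentum z) (configEnergy z))
    (ω := fun z => min 1 (‖(Real.sqrt θ)⁻¹ • ((((N : ℝ) + 1))⁻¹ • (configMomentum z) - u₀)‖ ^ 2 +
      ((θ * ((N : ℝ) + 1))⁻¹ * (2 * (configEnergy z) - 2 * inner ℝ u₀ (configMomentum z) +
        ((N : ℝ) + 1) * ‖u₀‖ ^ 2) / 3 - 1) ^ 2))
    (n := (N : ℝ) + 1) (δ := δ) (A₀ := A₀) (C₀ := C₀) (κ := A₀ / (2 * C₀)) (Cf := Cf)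
    hqm hωm (fun z => hf0 _ _) (fun z => hfC _ _)
    (fun z => le_min zero_le_one (by positivity)) (fun z => min_le_left _ _)
    (by positivity) hA₀.le hκ hq1 hmean hcher hAn

end Summit.AtomisticToContinuum.HydrodynamicLimit.Theorems.AlmostInvariantDuality

end
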